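import Summits.QuantumFields.YangMills.Theorems.AlphaInputsT3ACv3EMLIterFirstOrderUniform
import Summits.QuantumFields.YangMills.Theorems.AlphaInputsT3ACv3LinearLiftMatrixLift
import Summits.QuantumFields.YangMills.Theorems.AlphaInputsT3ACv3LinearLiftSmoothLin
import HarnessLib

/-!
# `AlphaInputsT3ACv3EMLIterFirstOrderUniformAllL` — [Balaban1985Averaging] PROP. 4 (134)–(135) AT THE FLAT BACKGROUND, `k`-UNIFORM AT **EVERY** BLOCK SIZE `L ≥ 2`:
# ★w1 g0's `EMLIterUniform.norm_iter_sub_one_sub_iterLin_le_uniform` WITHOUT the proviso `d + 2 ≤ L` — the remainder is propagated by a DUHAMEL SUM through the `k`-uniform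
# multi-step bound of the iterated (0.4)-linear average (★w2∕★w3's sup-small exact lift `liftS` as the integrator) instead of one step at a time — so that the (FL) row's
# Newton route covers `L = 3`, which the cruxes `HistoryTailL` ∕ `FluctuationComparisonRegPrIntL` ∕ 2′χ need (`∀ odd L > 1`) — cell `ym3-torus`, width seat `ym-ust-19936-w5` (g0);
# this seat's LOCATED NOTE 2026-08-28T01:21Z (★w2 g2 concurring 01:24Z)

WHY.  ★w1's R1 (p591454) carries `d + 2 ≤ L` (for `d = 3`: `L ≥ 5`) because its remainder recursion `r_{s+1} = (d+1)L·r_s + 324ℓ²m_s²` is propagated ONE step at a time with the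
one-step amplification `(d+1)L` of `Q₁` (`norm_linAvg_le_sharp`), and `(d+1)L ≤ L²` is needed for the closed form to survive (`step_dominates`); at `L = 3` the step-by-step bound
grows like `(12/9)^s`.  That is an artifact: the `s`-fold composite `Q^{(s)}` has sup norm `(d+1)·L^s` with an `s`-INDEPENDENT constant (★w1's own `LinearAvgSup.abs_linAvgIter_le`,
ported to matrices by ★w3 as `LinearLiftMatrix.norm_linAvgIterM_le`), so the error CREATED at step `t` (`R_t`, `‖R_t‖ ≤ 324ℓ²m_t²`, Prop. 3 at radius `2m_t`) should be transported to
level `s` by the MULTI-step map at cost `(d+1)L^{s−t−1}`, giving the geometric Duhamel sum `Σ_{t<s} L^{s−1−t}·m_t² ≲ m_s²/(L(L−1))` for every `L ≥ 2`.  To stay inside base-0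
objects (no re-based iterates) the transport is realised by the SUP-SMALL EXACT LIFT: `D_s = Q^{(s)}Δ_s` with the finest-lattice field `Δ_{s+1} := Δ_s + liftS_{s+1}(R_s)`
(`linAvgIter (s+1) (liftS (s+1) R) = R` — ★w2 g2's `linAvgIter_liftS`; `|liftS (s+1) R| ≤ 18^d(2+(d+1)18^d)·‖R‖/L^{s+1}` — `abs_liftS_le`; matrix port by ★w3's `byEntry` ∕
`norm_byEntry_le_of_bound`), whence `‖Δ_s‖ ≤ E·m_s²/L^s` with `E = C_S·324ℓ²/(L(L−1))` EXACTLY propagating (`E·m_s²/L^s + C_S·324ℓ²m_s²/L^{s+1} = E·m_{s+1}²/L^{s+1}`), and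
`r_s = ‖Q^{(s)}Δ_s‖ ≤ (d+1)L^s·E·m_s²/L^s = (d+1)E·m_s²`.
WHAT IS HERE (no definition).  §1 `linAvgIterM_byEntry_liftS` (exactness of the entrywise smooth lift at its level, `k ≤ m + K`), `norm_byEntry_liftS_le` (its `L^{−k}` sup bound, same
constant as the scalar one), `linAvgIterM_add`; §2 ★★ `norm_iter_sub_one_sub_iterLin_le_uniform_allL`: for every `SU(N)` field `U` on the finest lattice with `‖U_b − 1‖ ≤ δ`, every
family `Q` of composites of `linAvg`, every `k ≤ m + K`, with `m_s := (d+1)·L^s·δ` (the natural scale, NO group-dimension factor — ★w3's `norm_iterLin_le'`) and the three smallness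
rows `C'·m_k ≤ 1`, `32ℓ·m_k ≤ 1`, `4ℓ·m_k < δ_N` (`ℓ = (d+2)L`, `C' = (d+1)·18^d(2+(d+1)18^d)·324ℓ²/(L(L−1))`): for all `s ≤ k` and level-`s` bonds `c`,
`‖Ū^{(s)}(c) − 1‖ ≤ 2m_s` and `‖Ū^{(s)}(c) − 1 − (Q^{(s)}(U−1))(c)‖ ≤ C'·m_s²` — NO condition on `L` beyond `L ≥ 2` (`Params.hL`).  The constant is larger than ★w1's `324L(d+2)²`
by the lift's `18^d`-factors; any consumer that has `d + 2 ≤ L` may keep using R1.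
HONEST FRAMING.  Flat background only, as R1; kernel bookkeeping over landed lemmas (★w1 R1's one-step Prop. 3 `norm_avgFun_sub_one_sub_linAvg_le`, ★w1∕★w3 sup bounds, ★w2 g2's
`liftS`); count-neutral helper toward R3 2′∕2′χ (FL) (`--supports stmt-QuantumFields-19936`); (FL), `hLift`, KIN are NOT proved here; registry untouched; nothing about d = 4, the
continuum, or a mass gap; YM₃ on T³ is rung R3, not Clay.

References: T. Bałaban, Commun. Math. Phys. 98 (1985) 17–51 [Balaban1985Averaging] (Prop. 3 (122)–(123) p.36, (127)–(133) pp.37–38, Prop. 4 (134)–(135) p.38); Commun. Math.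
Phys. 109 (1987) 249–301 [Balaban1987RG1] ((0.4), (0.11) p.253).
-/

set_option autoImplicit false

noncomputable section

namespace Summit.QuantumFields.YangMills.Theorems.EMLIterUniformAllL

open Finset
open scoped Matrix.Norms.L2Operator
open Literature.MathematicalPhysics.QuantumFieldTheory.Balaban1983to89
open T4Continuum AveragingRT BlockAveraging ExpMeanLog BlockAveragingEMLLinearised
open Summit.QuantumFields.YangMills.Theorems.Prop7LinAvgOnto (linAvg_add)
open Summit.QuantumFields.YangMills.Theorems.Prop7AvgLinearisation (iter_zero_apply' iter_succ_eq_avgFun')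
open Summit.QuantumFields.YangMills.Theorems.LinearLiftMatrix (byEntry byEntry_comp byEntry_id byEntry_congr norm_byEntry_le_of_bound linAvgIterM
  linAvgIterM_zero linAvgIterM_succ linAvgIterM_eq_byEntry iterLin_eq_linAvgIterM norm_linAvgIterM_le norm_iterLin_le')
open Summit.QuantumFields.YangMills.Theorems.LinearLiftSpread (liftS liftSL liftSL_apply linAvgIter_liftS abs_liftS_le)
open Summit.QuantumFields.YangMills.Theorems.AbelianEML (linAvgIter)

variable {P : Params} {n : Type*} [Fintype n] [DecidableEq n] [Nonempty n]

/-! ## §1 The matrix smooth lift (entrywise `liftS`): exact at its level, `L^{−k}`-small in sup -/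

/-- **EXACTNESS OF THE ENTRYWISE SMOOTH LIFT AT ITS LEVEL**: `linAvgIterM k (byEntry (liftS k) A) = A` (`k ≤ m + K`) — ★w2 g2's `linAvgIter_liftS` through ★w3's
`linAvgIterM_eq_byEntry` ∕ `byEntry_comp` ∕ `byEntry_id` (verbatim the proof of `linAvgIterM_liftM`). [cite: Balaban1987RG1, (0.4)+(0.11) p.253] -/
theorem linAvgIterM_byEntry_liftS (k : ℕ) (hk : k ≤ P.m + P.K) (A : PBond P k → Matrix n n ℂ) :
    linAvgIterM k (byEntry (liftS k) A) = A := by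
  rw [linAvgIterM_eq_byEntry, byEntry_comp]
  have h : ((linAvgIter k) ∘ (liftS k) : (PBond P k → ℝ) → (PBond P k → ℝ)) = id := funext fun f => linAvgIter_liftS k hk f
  rw [h, byEntry_id]

omit [Nonempty n] in
/-- **THE ENTRYWISE SMOOTH LIFT IS `L^{−k}`-SMALL IN SUP, SAME CONSTANT AS THE SCALAR ONE**: `‖A c‖ ≤ M` ⇒ `‖byEntry (liftS k) A b‖ ≤ (18^d(2+(d+1)18^d)/L^k)·M`
(★w2 g2's `abs_liftS_le` through ★w3's `norm_byEntry_le_of_bound`). [cite: Balaban1985Averaging, (125) p.36 (bookkeeping); Balaban1987RG1, (0.4)+(0.11) p.253] -/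
theorem norm_byEntry_liftS_le (k : ℕ) (hk : k ≤ P.m + P.K) (A : PBond P k → Matrix n n ℂ) {M : ℝ} (hA : ∀ c, ‖A c‖ ≤ M) (b : PBond P 0) :
    ‖byEntry (liftS k) A b‖ ≤ ((18 : ℝ) ^ P.d * (2 + ((P.d : ℝ) + 1) * (18 : ℝ) ^ P.d) / (P.L : ℝ) ^ k) * M := by
  classical
  have hM : 0 ≤ M := (norm_nonneg _).trans (hA ⟨fun _ => 0, b.dir⟩)
  rw [byEntry_congr (T := liftS k) (fun f => (liftSL_apply k f).symm)]
  refine norm_byEntry_le_of_bound (liftSL P k) (fun _ => True) b (fun f M' hf => ?_) A hM fun c _ => hA c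
  have h := abs_liftS_le k hk f (fun c => hf c trivial) b
  rw [liftSL_apply]
  calc |liftS k f b| ≤ (18 : ℝ) ^ P.d * (2 + ((P.d : ℝ) + 1) * (18 : ℝ) ^ P.d) * M' / (P.L : ℝ) ^ k := h
    _ = ((18 : ℝ) ^ P.d * (2 + ((P.d : ℝ) + 1) * (18 : ℝ) ^ P.d) / (P.L : ℝ) ^ k) * M' := by ring

omit [Fintype n] [DecidableEq n] [Nonempty n] in
/-- The iterated matrix linearised average is additive (`linAvg_add` iterated). [cite: Balaban1987RG1, (0.11) p.253] -/
theorem linAvgIterM_add : ∀ (s : ℕ) (A B : PBond P 0 → Matrix n n ℂ) (c : PBond P s),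
    linAvgIterM s (fun b => A b + B b) c = linAvgIterM s A c + linAvgIterM s B c
  | 0, A, B, c => rfl
  | s + 1, A, B, c => by
    rw [linAvgIterM_succ, linAvgIterM_succ, linAvgIterM_succ, ← linAvg_add]
    congr 1
    funext b
    exact linAvgIterM_add s A B b

/-! ## §2 Proposition 4 at the flat background, `k`-uniform at EVERY block size -/

/-- ★★ **[Balaban1985Averaging] PROP. 4 (134)–(135) AT THE FLAT BACKGROUND, `k`-UNIFORM, AT EVERY BLOCK SIZE `L ≥ 2`.**  Let `Q` be any family with `Q 0 Y = Y`,
`Q (s+1) Y c = linAvg (Q s Y) c`, let `k ≤ m + K`, and let `U` be an `SU(N)` field on the finest lattice with `‖U_b − 1‖ ≤ δ`; put `Y = U − 1`, `m_s = (d+1)·L^s·δ`, `ℓ = (d+2)L`,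
`C' = (d+1)·18^d(2+(d+1)18^d)·324ℓ²/(L(L−1))`.  If `C'·m_k ≤ 1`, `32ℓ·m_k ≤ 1` and `4ℓ·m_k < δ_N` then for every `s ≤ k` and every level-`s` bond `c`: `‖Ū^{(s)}(c) − 1‖ ≤ 2m_s` and
`‖Ū^{(s)}(c) − 1 − (Q^{(s)}Y)(c)‖ ≤ C'·m_s²`.  Induction carrying the Duhamel representation `Ū^{(s)} − 1 − Q^{(s)}Y = Q^{(s)}Δ_s`, `‖Δ_s‖ ≤ E·m_s²/L^s`, `E = 18^d(2+(d+1)18^d)·324ℓ²/(L(L−1))`: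
the level-`s` field is `1 + Q^{(s)}Y + Q^{(s)}Δ_s` with norm `≤ 2m_s`, Prop. 3 (`norm_avgFun_sub_one_sub_linAvg_le`) gives the new error `‖R_s‖ ≤ 324ℓ²m_s²`, `Q₁(Q^{(s)}Y + Q^{(s)}Δ_s) =
Q^{(s+1)}Y + Q^{(s+1)}Δ_s`, and `Δ_{s+1} := Δ_s + liftS_{s+1}(R_s)` has `Q^{(s+1)}Δ_{s+1} = Q^{(s+1)}Δ_s + R_s` (exactness) and the propagated bound (§ module doc) — no `step_dominates`, no
condition on `L`. [cite: Balaban1985Averaging, Prop. 4 (134)–(135) p.38, (127)–(133) pp.37–38; Balaban1987RG1, (0.4)+(0.11) p.253] -/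
theorem norm_iter_sub_one_sub_iterLin_le_uniform_allL
    (Q : (i : ℕ) → (PBond P 0 → Matrix n n ℂ) → PBond P i → Matrix n n ℂ)
    (hQ0 : ∀ Y, Q 0 Y = Y) (hQs : ∀ (i : ℕ) (Y : PBond P 0 → Matrix n n ℂ) (c : PBond P (i + 1)), Q (i + 1) Y c = linAvg (Q i Y) c)
    (U : GaugeField P 0 (Matrix.specialUnitaryGroup n ℂ)) {δ : ℝ} (hδ : 0 ≤ δ)
    (hU : ∀ b, ‖((U b : Matrix.specialUnitaryGroup n ℂ) : Matrix n n ℂ) - 1‖ ≤ δ) (k : ℕ) (hk : k ≤ P.m + P.K)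
    (hm : (((P.d : ℝ) + 1) * ((18 : ℝ) ^ P.d * (2 + ((P.d : ℝ) + 1) * (18 : ℝ) ^ P.d)) * (324 * (((P.d + 2) * P.L : ℕ) : ℝ) ^ 2) /
        ((P.L : ℝ) * ((P.L : ℝ) - 1))) * (((P.d : ℝ) + 1) * (P.L : ℝ) ^ k * δ) ≤ 1)
    (h32 : 32 * (((P.d + 2) * P.L : ℕ) : ℝ) * (((P.d : ℝ) + 1) * (P.L : ℝ) ^ k * δ) ≤ 1)
    (hN : 4 * (((P.d + 2) * P.L : ℕ) : ℝ) * (((P.d : ℝ) + 1) * (P.L : ℝ) ^ k * δ) < deltaSU n) :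
    ∀ s : ℕ, s ≤ k → ∀ c : PBond P s,
      ‖((Averaging.iter (fun i => blockAvg (P := P) (j := i) (expMeanLogSU (n := n))) s U c : Matrix.specialUnitaryGroup n ℂ) : Matrix n n ℂ) - 1‖ ≤
          2 * (((P.d : ℝ) + 1) * (P.L : ℝ) ^ s * δ) ∧
      ‖((Averaging.iter (fun i => blockAvg (P := P) (j := i) (expMeanLogSU (n := n))) s U c : Matrix.specialUnitaryGroup n ℂ) : Matrix n n ℂ) - 1 -
          Q s (fun b => ((U b : Matrix.specialUnitaryGroup n ℂ) : Matrix n n ℂ) - 1) c‖ ≤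
        (((P.d : ℝ) + 1) * ((18 : ℝ) ^ P.d * (2 + ((P.d : ℝ) + 1) * (18 : ℝ) ^ P.d)) * (324 * (((P.d + 2) * P.L : ℕ) : ℝ) ^ 2) /
          ((P.L : ℝ) * ((P.L : ℝ) - 1))) * (((P.d : ℝ) + 1) * (P.L : ℝ) ^ s * δ) ^ 2 := by
  classical
  -- letters
  set ℓ : ℝ := (((P.d + 2) * P.L : ℕ) : ℝ) with hℓ
  set CS : ℝ := (18 : ℝ) ^ P.d * (2 + ((P.d : ℝ) + 1) * (18 : ℝ) ^ P.d) with hCS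
  set E : ℝ := CS * (324 * ℓ ^ 2) / ((P.L : ℝ) * ((P.L : ℝ) - 1)) with hE
  set C : ℝ := ((P.d : ℝ) + 1) * CS * (324 * ℓ ^ 2) / ((P.L : ℝ) * ((P.L : ℝ) - 1)) with hC
  set Y : PBond P 0 → Matrix n n ℂ := fun b => ((U b : Matrix.specialUnitaryGroup n ℂ) : Matrix n n ℂ) - 1 with hY
  let m : ℕ → ℝ := fun s => ((P.d : ℝ) + 1) * (P.L : ℝ) ^ s * δ
  have hm_def : ∀ s, m s = ((P.d : ℝ) + 1) * (P.L : ℝ) ^ s * δ := fun s => rfl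
  have hL1 : (1 : ℝ) < P.L := by exact_mod_cast P.hL.2
  have hL0 : (0 : ℝ) < P.L := by linarith
  have hLL : 0 < (P.L : ℝ) * ((P.L : ℝ) - 1) := mul_pos hL0 (by linarith)
  have hd0 : (0 : ℝ) ≤ P.d := Nat.cast_nonneg _
  have hℓ0 : 0 ≤ ℓ := by rw [hℓ]; exact Nat.cast_nonneg _
  have hCS0 : 0 ≤ CS := by rw [hCS]; positivity
  have hE0 : 0 ≤ E := by rw [hE]; positivity
  have hC0 : 0 ≤ C := by rw [hC]; positivity
  have hCE : C = ((P.d : ℝ) + 1) * E := by rw [hC, hE]; ring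
  have hm0 : ∀ s, 0 ≤ m s := fun s => by rw [hm_def]; positivity
  have hmsucc : ∀ s, m (s + 1) = (P.L : ℝ) * m s := fun s => by rw [hm_def, hm_def, pow_succ]; ring
  have hmono : ∀ s, s ≤ k → m s ≤ m k := fun s hs => by
    rw [hm_def, hm_def]
    have hpow : (P.L : ℝ) ^ s ≤ (P.L : ℝ) ^ k := pow_le_pow_right₀ hL1.le hs
    have : ((P.d : ℝ) + 1) * (P.L : ℝ) ^ s ≤ ((P.d : ℝ) + 1) * (P.L : ℝ) ^ k := mul_le_mul_of_nonneg_left hpow (by positivity)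
    exact mul_le_mul_of_nonneg_right this hδ
  have hYδ : ∀ b, ‖Y b‖ ≤ δ := hU
  -- the main term on its natural scale (no group-dimension factor)
  have hmain : ∀ (s : ℕ) (c : PBond P s), ‖Q s Y c‖ ≤ m s := fun s c => by
    have h := norm_iterLin_le' Q hQ0 hQs Y hYδ s c
    rwa [hm_def]
  -- the key step of the geometric bookkeeping: `E·m_s²/L^s + CS·324ℓ²·m_s²/L^{s+1} = E·m_{s+1}²/L^{s+1}`
  have hEL : E * ((P.L : ℝ) * ((P.L : ℝ) - 1)) = CS * (324 * ℓ ^ 2) := by rw [hE]; exact div_mul_cancel₀ _ hLL.ne'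
  have hEL2 : E * (P.L : ℝ) + CS * (324 * ℓ ^ 2) = E * (P.L : ℝ) ^ 2 := by linear_combination (-1 : ℝ) * hEL
  have hstep : ∀ s : ℕ, E * (m s) ^ 2 / (P.L : ℝ) ^ s + CS * (324 * ℓ ^ 2 * (m s) ^ 2) / (P.L : ℝ) ^ (s + 1) =
      E * (m (s + 1)) ^ 2 / (P.L : ℝ) ^ (s + 1) := fun s => by
    have hLs : (P.L : ℝ) ^ s ≠ 0 := (pow_pos hL0 s).ne'
    have hL0' : (P.L : ℝ) ≠ 0 := hL0.ne'
    calc E * (m s) ^ 2 / (P.L : ℝ) ^ s + CS * (324 * ℓ ^ 2 * (m s) ^ 2) / (P.L : ℝ) ^ (s + 1)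
        = (E * (P.L : ℝ) + CS * (324 * ℓ ^ 2)) * (m s) ^ 2 / (P.L : ℝ) ^ (s + 1) := by
          rw [pow_succ]; field_simp; ring
      _ = (E * (P.L : ℝ) ^ 2) * (m s) ^ 2 / (P.L : ℝ) ^ (s + 1) := by rw [hEL2]
      _ = E * (m (s + 1)) ^ 2 / (P.L : ℝ) ^ (s + 1) := by rw [hmsucc]; ring
  -- the induction: the remainder `D_s = Ū^{(s)} − 1 − Q^{(s)}Y` is `linAvgIterM s Δ_s` with `‖Δ_s‖ ≤ E·m_s²/L^s` (Duhamel: `Δ_{s+1} = Δ_s + liftS_{s+1}(R_s)`)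
  have key : ∀ s : ℕ, s ≤ k → ∃ Δ : PBond P 0 → Matrix n n ℂ, (∀ b, ‖Δ b‖ ≤ E * (m s) ^ 2 / (P.L : ℝ) ^ s) ∧
      ∀ c : PBond P s,
        ((Averaging.iter (fun i => blockAvg (P := P) (j := i) (expMeanLogSU (n := n))) s U c : Matrix.specialUnitaryGroup n ℂ) : Matrix n n ℂ) - 1 -
          Q s Y c = linAvgIterM s Δ c := by
    intro s
    induction s with
    | zero =>
      intro _
      refine ⟨fun _ => 0, fun b => by rw [norm_zero]; positivity, fun c => ?_⟩
      rw [iter_zero_apply', hQ0, linAvgIterM_zero, sub_self]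
    | succ s ih =>
      intro hsk
      have hs : s ≤ k := (Nat.le_succ s).trans hsk
      obtain ⟨Δ, hΔ, hrep⟩ := ih hs
      -- sizes at level `s`
      have hLs : (0 : ℝ) < (P.L : ℝ) ^ s := pow_pos hL0 s
      have hDs : ∀ c : PBond P s, ‖linAvgIterM s Δ c‖ ≤ C * (m s) ^ 2 := fun c => by
        have h := norm_linAvgIterM_le s Δ hΔ c
        calc ‖linAvgIterM s Δ c‖ ≤ ((P.d : ℝ) + 1) * (P.L : ℝ) ^ s * (E * (m s) ^ 2 / (P.L : ℝ) ^ s) := h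
          _ = C * (m s) ^ 2 := by rw [hCE]; field_simp
      have hCm : C * m s ≤ 1 := (mul_le_mul_of_nonneg_left (hmono s hs) hC0).trans hm
      have hDm : C * (m s) ^ 2 ≤ m s := by
        have : C * (m s) ^ 2 = (C * m s) * m s := by ring
        rw [this]; exact (mul_le_mul_of_nonneg_right hCm (hm0 s)).trans_eq (one_mul _)
      set W : GaugeField P s (Matrix.specialUnitaryGroup n ℂ) :=
        Averaging.iter (fun i => blockAvg (P := P) (j := i) (expMeanLogSU (n := n))) s U with hW
      have hW1 : ∀ b, ‖((W b : Matrix.specialUnitaryGroup n ℂ) : Matrix n n ℂ) - 1‖ ≤ 2 * m s := fun b => by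
        have e : ((W b : Matrix.specialUnitaryGroup n ℂ) : Matrix n n ℂ) - 1 = Q s Y b + linAvgIterM s Δ b := by
          rw [← hrep b, add_sub_cancel]
        rw [e]
        exact (norm_add_le _ _).trans (by linarith [hmain s b, hDs b, hDm])
      -- the one-step hypotheses at scale `2 m_s`
      have h2m0 : 0 ≤ 2 * m s := by linarith [hm0 s]
      have h16 : 16 * (ℓ * (2 * m s)) ≤ 1 := by
        have h2 : 16 * (ℓ * (2 * m s)) = (32 * ℓ) * m s := by ring
        rw [h2]
        exact (mul_le_mul_of_nonneg_left (hmono s hs) (by positivity)).trans (by rw [hℓ]; exact h32)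
      have hNs : 2 * (ℓ * (2 * m s)) < deltaSU n := by
        have : 2 * (ℓ * (2 * m s)) ≤ 4 * ℓ * m k := by nlinarith [hmono s hs, hℓ0]
        exact this.trans_lt (by rw [hℓ]; exact hN)
      -- Prop. 3 at level `s` (the NEW error `R_s`)
      set R : PBond P (s + 1) → Matrix n n ℂ := fun c =>
        ((avgFun (expMeanLogSU (n := n)) W c : Matrix.specialUnitaryGroup n ℂ) : Matrix n n ℂ) - 1 -
          linAvg (fun b => ((W b : Matrix.specialUnitaryGroup n ℂ) : Matrix n n ℂ) - 1) c with hR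
      have hRb : ∀ c, ‖R c‖ ≤ 324 * ℓ ^ 2 * (m s) ^ 2 := fun c => by
        have hone := norm_avgFun_sub_one_sub_linAvg_le (n := n) W h2m0 hW1 h16 hNs c
        calc ‖R c‖ ≤ 81 * (ℓ * (2 * m s)) ^ 2 := hone
          _ = 324 * ℓ ^ 2 * (m s) ^ 2 := by ring
      -- the Duhamel update `Δ' := Δ + liftS_{s+1}(R_s)`
      refine ⟨fun b => Δ b + byEntry (liftS (s + 1)) R b, fun b => ?_, fun c => ?_⟩
      · have h1 := hΔ b
        have h2 := norm_byEntry_liftS_le (s + 1) (hsk.trans hk) R hRb b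
        calc ‖Δ b + byEntry (liftS (s + 1)) R b‖ ≤ ‖Δ b‖ + ‖byEntry (liftS (s + 1)) R b‖ := norm_add_le _ _
          _ ≤ E * (m s) ^ 2 / (P.L : ℝ) ^ s + CS / (P.L : ℝ) ^ (s + 1) * (324 * ℓ ^ 2 * (m s) ^ 2) := add_le_add h1 h2
          _ = E * (m s) ^ 2 / (P.L : ℝ) ^ s + CS * (324 * ℓ ^ 2 * (m s) ^ 2) / (P.L : ℝ) ^ (s + 1) := by ring
          _ = E * (m (s + 1)) ^ 2 / (P.L : ℝ) ^ (s + 1) := hstep s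
      · -- `Ū^{(s+1)} − 1 − Q^{(s+1)}Y = Q₁ D_s + R_s = linAvgIterM (s+1) Δ + R_s = linAvgIterM (s+1) Δ'`
        have hsplit : linAvg (fun b => ((W b : Matrix.specialUnitaryGroup n ℂ) : Matrix n n ℂ) - 1) c = Q (s + 1) Y c + linAvgIterM (s + 1) Δ c := by
          have e : (fun b => ((W b : Matrix.specialUnitaryGroup n ℂ) : Matrix n n ℂ) - 1) = fun b => Q s Y b + linAvgIterM s Δ b := by
            funext b; rw [← hrep b, add_sub_cancel]
          rw [e, linAvg_add, hQs, linAvgIterM_succ]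
        rw [iter_succ_eq_avgFun', linAvgIterM_add, linAvgIterM_byEntry_liftS (s + 1) (hsk.trans hk) R]
        have e2 : ((avgFun (expMeanLogSU (n := n)) W c : Matrix.specialUnitaryGroup n ℂ) : Matrix n n ℂ) - 1 - Q (s + 1) Y c =
            (((avgFun (expMeanLogSU (n := n)) W c : Matrix.specialUnitaryGroup n ℂ) : Matrix n n ℂ) - 1 -
              linAvg (fun b => ((W b : Matrix.specialUnitaryGroup n ℂ) : Matrix n n ℂ) - 1) c) + linAvgIterM (s + 1) Δ c := by
          rw [hsplit]; abel
        rw [e2, hR, add_comm]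
  -- assemble
  intro s hs c
  obtain ⟨Δ, hΔ, hrep⟩ := key s hs
  have hD : ‖linAvgIterM s Δ c‖ ≤ C * (m s) ^ 2 := by
    have hLs : (0 : ℝ) < (P.L : ℝ) ^ s := pow_pos hL0 s
    have h := norm_linAvgIterM_le s Δ hΔ c
    calc ‖linAvgIterM s Δ c‖ ≤ ((P.d : ℝ) + 1) * (P.L : ℝ) ^ s * (E * (m s) ^ 2 / (P.L : ℝ) ^ s) := h
      _ = C * (m s) ^ 2 := by rw [hCE]; field_simp
  have h2 : ‖((Averaging.iter (fun i => blockAvg (P := P) (j := i) (expMeanLogSU (n := n))) s U c : Matrix.specialUnitaryGroup n ℂ) : Matrix n n ℂ) - 1 -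
      Q s Y c‖ ≤ C * (m s) ^ 2 := by rw [hrep c]; exact hD
  refine ⟨?_, h2⟩
  have hCm : C * m s ≤ 1 := (mul_le_mul_of_nonneg_left (hmono s hs) hC0).trans hm
  have hDm : C * (m s) ^ 2 ≤ m s := by
    have : C * (m s) ^ 2 = (C * m s) * m s := by ring
    rw [this]; exact (mul_le_mul_of_nonneg_right hCm (hm0 s)).trans_eq (one_mul _)
  have e : ((Averaging.iter (fun i => blockAvg (P := P) (j := i) (expMeanLogSU (n := n))) s U c : Matrix.specialUnitaryGroup n ℂ) : Matrix n n ℂ) - 1 =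
      Q s Y c + (((Averaging.iter (fun i => blockAvg (P := P) (j := i) (expMeanLogSU (n := n))) s U c : Matrix.specialUnitaryGroup n ℂ) : Matrix n n ℂ) - 1 - Q s Y c) := by
    abel
  rw [e]
  exact (norm_add_le _ _).trans (by linarith [hmain s c])

end Summit.QuantumFields.YangMills.Theorems.EMLIterUniformAllL

end
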